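import Mathlib

/-!
# Route `HolmgrenBoyleLind`, item `FiniteRigidity` (stmt-AtomisticToContinuum-6078): directional
vanishing of real-analytic germs

Helper file.  If `Ψ` is real-analytic at `0`, vanishes on a set `S` of non-zero vectors, and every
unit vector is a limit of directions `u/‖u‖` of points `u ∈ S` tending to `0`, then `Ψ` vanishes
identically near `0`: by strong induction on the degree `n`, the diagonal `p n (y, …, y)` of the
`n`-th Taylor coefficient vanishes at every limit direction (Taylor remainder `O(‖y‖ⁿ⁺¹)` plus
homogeneity of degree `n`), hence on the unit sphere, hence everywhere; and a power series all of
whose diagonals vanish sums to `0`.  This is the «every direction is a limit direction, so the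
homogeneous parts die one by one» step of the route text, run after a Kelvin inversion.
All `[folklore]`.
-/

noncomputable section

namespace Summit.AtomisticToContinuum.Crystallization.Theorems.HolmgrenBoyleLind

open scoped BigOperators Topology
open Filter Set

variable {E F : Type*} [NormedAddCommGroup E] [NormedSpace ℝ E] [NormedAddCommGroup F]
  [NormedSpace ℝ F]

/-- The diagonal of a continuous multilinear map is continuous. [folklore] -/
theorem continuous_diagonal {n : ℕ} (P : ContinuousMultilinearMap ℝ (fun _ : Fin n => E) F) :
    Continuous fun y : E => P fun _ => y :=
  P.cont.comp (continuous_pi fun _ => continuous_id)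

/-- Homogeneity of the diagonal: `P(c y, …, c y) = c ^ n • P(y, …, y)`. [folklore] -/
theorem diagonal_smul {n : ℕ} (P : ContinuousMultilinearMap ℝ (fun _ : Fin n => E) F) (c : ℝ)
    (y : E) : P (fun _ => c • y) = c ^ n • P (fun _ => y) := by
  have := P.map_smul_univ (fun _ : Fin n => c) (fun _ => y)
  simp only [Finset.prod_const, Finset.card_univ, Fintype.card_fin] at this
  exact this

/-- **Directional vanishing of Taylor diagonals.** If `Ψ` has the power series `p` at `0`,
vanishes on `S`, and every unit vector is a limit of directions `u/‖u‖` of points `u ∈ S`,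
`u → 0`, then every diagonal `p n (y, …, y)` vanishes. [folklore] -/
theorem apply_diagonal_eq_zero_of_directions [Nontrivial E] {Ψ : E → F}
    {p : FormalMultilinearSeries ℝ E F} (hp : HasFPowerSeriesAt Ψ p 0) {S : Set E}
    (hS : ∀ u ∈ S, Ψ u = 0)
    (hdir : ∀ ω : E, ‖ω‖ = 1 → ∀ ε : ℝ, 0 < ε →
      ∃ u ∈ S, u ≠ 0 ∧ ‖u‖ < ε ∧ ‖‖u‖⁻¹ • u - ω‖ < ε) :
    ∀ (n : ℕ) (y : E), p n (fun _ => y) = 0 := by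
  intro n
  induction n using Nat.strong_induction_on with
  | _ n ih =>
  -- the partial sum of order `n + 1` is the `n`-th diagonal
  have hps : ∀ y : E, p.partialSum (n + 1) y = p n (fun _ => y) := by
    intro y
    rw [FormalMultilinearSeries.partialSum, Finset.sum_range_succ, Finset.sum_eq_zero, zero_add]
    intro i hi
    exact ih i (Finset.mem_range.1 hi) y
  obtain ⟨C, hC⟩ := (hp.isBigO_sub_partialSum_pow (n + 1)).bound
  obtain ⟨ρ, hρ, hball⟩ := Metric.eventually_nhds_iff.1 hC
  have hCpos : 0 < |C| + 1 := by positivity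
  -- Step 1: unit vectors
  have hunit : ∀ ω : E, ‖ω‖ = 1 → p n (fun _ => ω) = 0 := by
    intro ω hω
    rw [← norm_le_zero_iff]
    refine le_of_forall_pos_le_add fun η hη => ?_
    rw [zero_add]
    obtain ⟨θ, hθ, hθball⟩ :=
      Metric.continuousAt_iff.1 ((continuous_diagonal (p n)).continuousAt (x := ω)) (η / 2)
        (half_pos hη)
    set ε : ℝ := min (min θ ρ) (η / 2 / (|C| + 1)) with hε
    have hεpos : 0 < ε := lt_min (lt_min hθ hρ) (by positivity)
    obtain ⟨u, huS, hu0, huε, hudir⟩ := hdir ω hω ε hεpos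
    have hupos : 0 < ‖u‖ := norm_pos_iff.2 hu0
    -- Taylor bound at `u`
    have hTaylor : ‖p n (fun _ => u)‖ ≤ |C| * ‖u‖ ^ (n + 1) := by
      have hu_ball : dist u 0 < ρ := by
        rw [dist_zero_right]
        exact lt_of_lt_of_le huε ((min_le_left _ _).trans (min_le_right _ _))
      have h1 := hball hu_ball
      rw [zero_add, hS u huS, hps, zero_sub, norm_neg] at h1
      refine h1.trans ?_
      rw [Real.norm_of_nonneg (by positivity)]
      gcongr
      exact le_abs_self C
    -- homogeneity: pass to the direction `‖u‖⁻¹ • u`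
    have hdirbound : ‖p n (fun _ => ‖u‖⁻¹ • u)‖ ≤ |C| * ‖u‖ := by
      rw [diagonal_smul, norm_smul, norm_pow, norm_inv, norm_norm]
      calc ‖u‖⁻¹ ^ n * ‖p n fun _ => u‖ ≤ ‖u‖⁻¹ ^ n * (|C| * ‖u‖ ^ (n + 1)) := by gcongr
        _ = |C| * ‖u‖ := by
          rw [pow_succ, inv_pow]
          field_simp
    -- continuity: the direction is close to `ω`
    have hclose : dist (p n fun _ => ‖u‖⁻¹ • u) (p n fun _ => ω) < η / 2 :=
      hθball (by
        rw [dist_eq_norm]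
        exact lt_of_lt_of_le hudir ((min_le_left _ _).trans (min_le_left _ _)))
    have hεle : ε ≤ η / 2 / (|C| + 1) := min_le_right _ _
    calc ‖p n fun _ => ω‖
        ≤ ‖p n fun _ => ‖u‖⁻¹ • u‖ + ‖(p n fun _ => ‖u‖⁻¹ • u) - p n fun _ => ω‖ :=
          norm_le_insert _ _
      _ ≤ |C| * ‖u‖ + η / 2 := by
          rw [← dist_eq_norm]
          gcongr
      _ ≤ |C| * (η / 2 / (|C| + 1)) + η / 2 := by
          gcongr
          exact huε.le.trans hεle
      _ ≤ (|C| + 1) * (η / 2 / (|C| + 1)) + η / 2 := by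
          gcongr
          linarith
      _ = η := by
          field_simp
          ring
  -- Step 2: all vectors, by homogeneity
  intro y
  by_cases hy : y = 0
  · subst hy
    rcases Nat.eq_zero_or_pos n with hn | hn
    · subst hn
      obtain ⟨v, hv⟩ := exists_ne (0 : E)
      have hω : ‖‖v‖⁻¹ • v‖ = 1 := by
        rw [norm_smul, norm_inv, norm_norm, inv_mul_cancel₀ (norm_ne_zero_iff.2 hv)]
      have h0 := hunit _ hω
      have hfun : (fun _ : Fin 0 => (0 : E)) = fun _ => ‖v‖⁻¹ • v := funext fun i => Fin.elim0 i
      rw [hfun]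
      exact h0
    · haveI : Nonempty (Fin n) := ⟨⟨0, hn⟩⟩
      exact (p n).map_zero
  · have hny : ‖y‖ ≠ 0 := norm_ne_zero_iff.2 hy
    have hω : ‖‖y‖⁻¹ • y‖ = 1 := by
      rw [norm_smul, norm_inv, norm_norm, inv_mul_cancel₀ hny]
    have h1 : p n (fun _ => y) = ‖y‖ ^ n • p n (fun _ => ‖y‖⁻¹ • y) := by
      rw [diagonal_smul, smul_smul, ← mul_pow, mul_inv_cancel₀ hny, one_pow, one_smul]
    rw [h1, hunit _ hω, smul_zero]

/-- **Directional identity principle at a point.** A real-analytic germ at `0` that vanishes on a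
set of non-zero vectors whose directions accumulate at every unit vector as the points tend to `0`
vanishes identically near `0`. [folklore] -/
theorem eventuallyEq_zero_of_directions [Nontrivial E] {Ψ : E → F} (hΨ : AnalyticAt ℝ Ψ 0)
    {S : Set E} (hS : ∀ u ∈ S, Ψ u = 0)
    (hdir : ∀ ω : E, ‖ω‖ = 1 → ∀ ε : ℝ, 0 < ε →
      ∃ u ∈ S, u ≠ 0 ∧ ‖u‖ < ε ∧ ‖‖u‖⁻¹ • u - ω‖ < ε) :
    Ψ =ᶠ[𝓝 0] 0 := by
  obtain ⟨p, hp⟩ := hΨ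
  have hall := apply_diagonal_eq_zero_of_directions hp hS hdir
  have h1 : ∀ᶠ y in 𝓝 (0 : E), Ψ (0 + y) = 0 := by
    filter_upwards [hp.eventually_hasSum] with y hy
    have : HasSum (fun n => p n fun _ => y) 0 := by
      simp only [hall]
      exact hasSum_zero
    exact hy.unique this
  filter_upwards [h1] with y hy
  simpa using hy

end Summit.AtomisticToContinuum.Crystallization.Theorems.HolmgrenBoyleLind

end
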